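import Mathlib.RingTheory.MvPolynomial.Homogeneous
import Literature.RingTheory.MvPolynomial.KaltofenNoetherFormsGeneric
import HarnessLib

/-!
# Towards Kaltofen's Theorem 7 (effective Noether forms): proofs — specialising the generic
# objects

Sibling proof file of `KaltofenNoetherFormsGeneric.lean` (E. Kaltofen, J. Comput. System Sci.
50 (1995) 274–295, §5 proof of Thm. 7: "Take a specific `f` and substitute its coefficients
`q_e` for the `c_e` into all `Φ_t`"). For a polynomial `f` of total degree `≤ d` over a
commutative ring `K` and the specialisation `spec q` at `q = (coeff e f)_e`:

* `map_spec_fgen` — the generic polynomial specialises to `f` (pushed into `K[params]`);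
* `map_spec_gline`, `map_spec_planeGen` — the generic line / plane sections specialise to the
  line / plane sections of `f` with indeterminate parameters;
* `spec_rhoBar` — `ρ̄` specialises to the resultant `Res_x^{d,d-1}(g, ∂g/∂x)` of the line
  section `g = f(μ + xv)` of `f`;
* `spec_lam` — `λ` specialises to `f_d(v)`, the top homogeneous component at the direction `v`;
* `aeval_extract` — the forms `σ = extract F m` evaluate to the coefficients of `spec q F`:
  `aeval q (extract F m) = coeff m (spec q F)`; hence all `σ ∈ S(F)` vanish at `q` iff
  `spec q F = 0` (`spec_eq_zero_iff`);
* `map_spec_clearedEval` — over a field in which `λ` specialises to `Λ ≠ 0`, the cleared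
  evaluation `λ^D Δ'` specialises to `Λ^D · Δ(N/Λ)`.

No definitions, no named facts.

## References

* E. Kaltofen, J. Comput. System Sci. 50 (1995) 274–295, §5 proof of Thm. 7. [Kaltofen1995]
-/

noncomputable section

open MvPolynomial
open scoped Polynomial

universe u

namespace Literature.RingTheory.MvPolynomial

namespace KaltofenGeneric

variable {n d : ℕ}

/-! ### The generic polynomial specialises to `f` -/

/-- Exponents of a polynomial of total degree `≤ d` lie in `exps n d`. [folklore] -/
theorem mem_exps_of_mem_support {R : Type*} [CommSemiring R] {f : MvPolynomial (Fin n) R}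
    (hf : f.totalDegree ≤ d) {e : Fin n →₀ ℕ} (he : e ∈ f.support) : e ∈ exps n d :=
  mem_exps.2 ((le_totalDegree he).trans hf)

/-- **`fgen` specialises to `f`.** [cite: Kaltofen1995, §5 proof of Thm. 7] -/
theorem map_spec_fgen {K : Type*} [CommRing K] (f : MvPolynomial (Fin n) K) (hf : f.totalDegree ≤ d) :
    MvPolynomial.map (spec fun e => f.coeff e) (fgen n d) =
      MvPolynomial.map (C : K →+* MvPolynomial (Params n) K) f := by
  classical
  ext e
  rw [coeff_map, coeff_map, fgen, coeff_sum]
  simp only [coeff_monomial]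
  rw [Finset.sum_ite_eq']
  split_ifs with h
  · rw [spec_X]
  · rw [map_zero]
    have : f.coeff e = 0 := by
      by_contra hne
      exact h (mem_exps_of_mem_support hf (mem_support_iff.2 hne))
    rw [this, C_0]

/-! ### The line and plane sections specialise -/

/-- **`gline` specialises to the line section `f(μ + xv)` of `f`** (indeterminate `μ, v`).
[cite: Kaltofen1995, §5 proof of Thm. 7] -/
theorem map_spec_gline {K : Type*} [CommRing K] (f : MvPolynomial (Fin n) K) (hf : f.totalDegree ≤ d) :
    (gline n d).map (spec fun e => f.coeff e) =
      MvPolynomial.aeval (fun i ↦ Polynomial.C (X (Sum.inr (Sum.inl i))) +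
        Polynomial.C (X (Sum.inr (Sum.inr i))) * Polynomial.X :
          Fin n → Polynomial (MvPolynomial (Params n) K)) f := by
  have key : (Polynomial.mapRingHom (spec fun e => f.coeff e)).comp
      (MvPolynomial.aeval (fun i ↦ Polynomial.C (μv n i) + Polynomial.C (vv n i) * Polynomial.X :
        Fin n → Polynomial (GenRing n))).toRingHom =
      (MvPolynomial.aeval (fun i ↦ Polynomial.C (X (Sum.inr (Sum.inl i))) +
        Polynomial.C (X (Sum.inr (Sum.inr i))) * Polynomial.X :
          Fin n → Polynomial (MvPolynomial (Params n) K))).toRingHom.comp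
        (MvPolynomial.map (spec fun e => f.coeff e)) := by
    refine MvPolynomial.ringHom_ext (fun a => ?_) (fun i => ?_)
    · simp only [RingHom.coe_comp, Function.comp_apply, AlgHom.toRingHom_eq_coe, RingHom.coe_coe,
        MvPolynomial.algHom_C, Polynomial.algebraMap_apply, Polynomial.coe_mapRingHom,
        Polynomial.map_C, MvPolynomial.map_C, Algebra.algebraMap_self_apply]
    · simp only [RingHom.coe_comp, Function.comp_apply, AlgHom.toRingHom_eq_coe, RingHom.coe_coe,
        MvPolynomial.aeval_X, Polynomial.coe_mapRingHom, Polynomial.map_add, Polynomial.map_mul,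
        Polynomial.map_C, Polynomial.map_X, MvPolynomial.map_X, spec_μv, spec_vv]
  have h := DFunLike.congr_fun key (fgen n d)
  simp only [RingHom.coe_comp, Function.comp_apply, AlgHom.toRingHom_eq_coe, RingHom.coe_coe,
    Polynomial.coe_mapRingHom] at h
  rw [gline, h, map_spec_fgen f hf, ← MvPolynomial.algebraMap_eq, MvPolynomial.aeval_map_algebraMap]

/-- **`planeGen` specialises to the plane section `f(μ + vx + zy)` of `f`** (indeterminate
`μ, v, z`). [cite: Kaltofen1995, §5 proof of Thm. 7] -/
theorem map_spec_planeGen {K : Type*} [CommRing K] (f : MvPolynomial (Fin n) K) (hf : f.totalDegree ≤ d) :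
    (planeGen n d).map (Polynomial.mapRingHom (spec fun e => f.coeff e)) =
      MvPolynomial.aeval (fun i ↦
        (Polynomial.C (Polynomial.C (X (Sum.inr (Sum.inl i)))) +
          Polynomial.C (Polynomial.C (X (Sum.inr (Sum.inr i)))) * Polynomial.X +
          Polynomial.C (Polynomial.C (X (Sum.inl i)) * Polynomial.X) :
            Polynomial (Polynomial (MvPolynomial (Params n) K)))) f := by
  have key : (Polynomial.mapRingHom (Polynomial.mapRingHom (spec fun e => f.coeff e))).comp
      (MvPolynomial.aeval (fun i ↦
        (Polynomial.C (Polynomial.C (μv n i)) + Polynomial.C (Polynomial.C (vv n i)) * Polynomial.X +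
          Polynomial.C (Polynomial.C (zv n i) * Polynomial.X) : Polynomial (Polynomial (GenRing n))))).toRingHom =
      (MvPolynomial.aeval (fun i ↦
        (Polynomial.C (Polynomial.C (X (Sum.inr (Sum.inl i)))) +
          Polynomial.C (Polynomial.C (X (Sum.inr (Sum.inr i)))) * Polynomial.X +
          Polynomial.C (Polynomial.C (X (Sum.inl i)) * Polynomial.X) :
            Polynomial (Polynomial (MvPolynomial (Params n) K))))).toRingHom.comp
        (MvPolynomial.map (spec fun e => f.coeff e)) := by
    refine MvPolynomial.ringHom_ext (fun a => ?_) (fun i => ?_)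
    · simp only [RingHom.coe_comp, Function.comp_apply, AlgHom.toRingHom_eq_coe, RingHom.coe_coe,
        MvPolynomial.algHom_C, Polynomial.algebraMap_apply, Polynomial.coe_mapRingHom,
        Polynomial.map_C, MvPolynomial.map_C, Algebra.algebraMap_self_apply]
    · simp only [RingHom.coe_comp, Function.comp_apply, AlgHom.toRingHom_eq_coe, RingHom.coe_coe,
        MvPolynomial.aeval_X, Polynomial.coe_mapRingHom, Polynomial.map_add, Polynomial.map_mul,
        Polynomial.map_C, Polynomial.map_X, MvPolynomial.map_X, spec_μv, spec_vv, spec_zv]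
  have h := DFunLike.congr_fun key (fgen n d)
  simp only [RingHom.coe_comp, Function.comp_apply, AlgHom.toRingHom_eq_coe, RingHom.coe_coe,
    Polynomial.coe_mapRingHom] at h
  rw [planeGen, h, map_spec_fgen f hf, ← MvPolynomial.algebraMap_eq, MvPolynomial.aeval_map_algebraMap]

/-- **`ρ̄` specialises to the discriminant of the line section of `f`** (when `d = deg f`, the
polynomial of `resultant_genericLine_derivative_ne_zero`). [cite: Kaltofen1995, §5 proof of Thm. 7 ("r is the image of the generic resultant ρ")] -/
theorem spec_rhoBar {K : Type*} [CommRing K] (f : MvPolynomial (Fin n) K) (hf : f.totalDegree ≤ d) :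
    spec (fun e => f.coeff e) (rhoBar n d) =
      Polynomial.resultant
        (MvPolynomial.aeval (fun i ↦ Polynomial.C (X (Sum.inr (Sum.inl i))) +
          Polynomial.C (X (Sum.inr (Sum.inr i))) * Polynomial.X :
            Fin n → Polynomial (MvPolynomial (Params n) K)) f)
        (Polynomial.derivative (MvPolynomial.aeval (fun i ↦ Polynomial.C (X (Sum.inr (Sum.inl i))) +
          Polynomial.C (X (Sum.inr (Sum.inr i))) * Polynomial.X :
            Fin n → Polynomial (MvPolynomial (Params n) K)) f)) d (d - 1) := by
  rw [rhoBar, ← Polynomial.resultant_map_map, ← Polynomial.derivative_map, map_spec_gline f hf]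

/-- **`λ` specialises to `f_d(v)`**, the degree-`d` homogeneous component of `f` at the
indeterminate direction `v`. [cite: Kaltofen1995, §4 (30)] -/
theorem spec_lam {K : Type*} [CommRing K] (f : MvPolynomial (Fin n) K) :
    spec (fun e => f.coeff e) (lam n d) =
      MvPolynomial.aeval (fun i => (X (Sum.inr (Sum.inr i)) : MvPolynomial (Params n) K))
        (homogeneousComponent d f) := by
  classical
  rw [lam, map_sum, homogeneousComponent_apply, map_sum]
  -- both sides are sums of `q_e v^e` over `|e| = d`; restrict the left sum to the support
  have hR : ∀ e ∈ topExps n d, spec (fun e => f.coeff e) (X e * ∏ i, vv n i ^ e i) =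
      C (f.coeff e) * ∏ i, (X (Sum.inr (Sum.inr i)) : MvPolynomial (Params n) K) ^ e i := by
    intro e _
    rw [map_mul, spec_X, map_prod]
    simp
  rw [Finset.sum_congr rfl hR]
  symm
  rw [← Finset.sum_filter_add_sum_filter_not (topExps n d) (fun e => e ∈ f.support)]
  have hzero : ∑ e ∈ (topExps n d).filter (fun e => e ∉ f.support),
      C (f.coeff e) * ∏ i, (X (Sum.inr (Sum.inr i)) : MvPolynomial (Params n) K) ^ e i = 0 := by
    refine Finset.sum_eq_zero fun e he => ?_
    rw [Finset.mem_filter] at he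
    rw [notMem_support_iff.1 he.2, C_0, zero_mul]
  rw [hzero, add_zero]
  have hset : f.support.filter (fun e => e.degree = d) = (topExps n d).filter (fun e => e ∈ f.support) := by
    ext e
    simp only [Finset.mem_filter, mem_topExps, Finsupp.degree]
    constructor
    · rintro ⟨h1, h2⟩; exact ⟨h2, h1⟩
    · rintro ⟨h1, h2⟩; exact ⟨h2, h1⟩
  rw [hset]
  refine Finset.sum_congr rfl fun e _ => ?_
  rw [aeval_monomial, MvPolynomial.algebraMap_eq, Finsupp.prod_fintype _ _ fun i => pow_zero _]

/-! ### The forms `σ = extract F m` evaluate to the coefficients of the specialisation -/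

/-- **Evaluation of the extracted forms:** `Φ(q) = coeff_m (spec_q F)` for `Φ = extract F m`.
[cite: Kaltofen1995, §5 proof of Thm. 7 ("substitute its coefficients q_e for the c_e")] -/
theorem aeval_extract {K : Type*} [CommRing K] (q : (Fin n →₀ ℕ) → K) (F : GenRing n) (m : Params n →₀ ℕ) :
    MvPolynomial.aeval q (extract F m) = coeff m (spec q F) := by
  classical
  conv_rhs => rw [F.as_sum]
  rw [extract, map_sum, map_sum, coeff_sum]
  refine Finset.sum_congr rfl fun e _ => ?_
  rw [aeval_monomial, spec, eval₂Hom_monomial]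
  have h1 : (e.prod fun cv k => (C (q cv) : MvPolynomial (Params n) K) ^ k) =
      C (e.prod fun cv k => q cv ^ k) := by
    rw [Finsupp.prod, Finsupp.prod, map_prod]
    exact Finset.prod_congr rfl fun cv _ => (C_pow _ _).symm
  rw [h1, mul_comm (MvPolynomial.map _ _) (C _), coeff_C_mul, coeff_map, algebraMap_int_eq]
  exact mul_comm _ _

/-- Outside `extractSupport F` the forms vanish, so "all forms of `F` vanish at `q`" is the
vanishing of the specialisation `spec_q F`. [cite: Kaltofen1995, §5 proof of Thm. 7] -/
theorem spec_eq_zero_iff {K : Type*} [CommRing K] (q : (Fin n →₀ ℕ) → K) (F : GenRing n) :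
    spec q F = 0 ↔ ∀ m ∈ extractSupport F, MvPolynomial.aeval q (extract F m) = 0 := by
  constructor
  · intro h m _
    rw [aeval_extract, h, coeff_zero]
  · intro h
    ext m
    rw [coeff_zero, ← aeval_extract]
    by_cases hm : m ∈ extractSupport F
    · exact h m hm
    · rw [extract_eq_zero_of_notMem hm, map_zero]

/-! ### The cleared evaluation `λ^D Δ'` specialises to `Λ^D Δ(N/Λ)` -/

/-- Homogeneous polynomials scale: `p(c x) = c^k p(x)` for `p` homogeneous of degree `k`.
[folklore] -/
theorem aeval_smul_of_isHomogeneous {R : Type*} [CommRing R] {A : Type*} [CommRing A] [Algebra R A]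
    {σ : Type*} {p : MvPolynomial σ R} {k : ℕ} (hp : p.IsHomogeneous k) (c : A) (x : σ → A) :
    MvPolynomial.aeval (fun i => c * x i) p = c ^ k * MvPolynomial.aeval x p := by
  classical
  conv_lhs => rw [p.as_sum]
  conv_rhs => rw [p.as_sum]
  rw [map_sum, map_sum, Finset.mul_sum]
  refine Finset.sum_congr rfl fun m hm => ?_
  rw [aeval_monomial, aeval_monomial]
  have hdeg : m.degree = k := by
    rw [Finsupp.degree_eq_weight_one]; exact hp (mem_support_iff.1 hm)
  simp only [Finsupp.prod, mul_pow, Finset.prod_mul_distrib]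
  rw [Finset.prod_pow_eq_pow_sum, show ∑ i ∈ m.support, m i = k from by
    rw [← hdeg, Finsupp.degree_apply]]
  ring

/-- A polynomial of total degree `≤ D` is the sum of its homogeneous components of degree
`≤ D`. [folklore] -/
theorem sum_homogeneousComponent_of_le {R : Type*} [CommSemiring R] {σ : Type*}
    (p : MvPolynomial σ R) {D : ℕ} (hD : p.totalDegree ≤ D) :
    ∑ k ∈ Finset.range (D + 1), homogeneousComponent k p = p := by
  conv_rhs => rw [← sum_homogeneousComponent p]
  symm
  refine Finset.sum_subset (Finset.range_subset_range.2 (by omega)) fun k _ hk => ?_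
  rw [Finset.mem_range] at hk
  exact homogeneousComponent_eq_zero _ _ (by omega)

/-- `aeval` of an integer polynomial commutes with ring maps. [folklore] -/
theorem ringHom_aeval_int {A B : Type*} [CommRing A] [CommRing B] [Algebra ℤ A] [Algebra ℤ B]
    (φ : A →+* B) {σ : Type*} (x : σ → A) (p : MvPolynomial σ ℤ) :
    φ (MvPolynomial.aeval x p) = MvPolynomial.aeval (fun i => φ (x i)) p := by
  rw [MvPolynomial.map_aeval, MvPolynomial.aeval_eq_eval₂Hom,
    RingHom.ext_int (φ.comp (algebraMap ℤ A)) (algebraMap ℤ B)]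

/-- **Specialisation of the cleared evaluation.** Let `φ : K[params] → F` be a ring map into
a field with `φ(spec λ) = Λ ≠ 0`, and let `Δ` have total degree `≤ D`. Then
`φ(spec (λ^D Δ')) = Λ^D · Δ((φ(spec N_b)/Λ)_b)`. [cite: Kaltofen1995, §5 proof of Thm. 7 ("each coefficient of the generic version of ψ₂ has as denominator λ")] -/
theorem map_spec_clearedEval {K : Type*} [CommRing K] {F : Type*} [Field F] (φ : MvPolynomial (Params n) K →+* F)
    (q : (Fin n →₀ ℕ) → K) {D : ℕ} (Δ : MvPolynomial (ℕ × ℕ) ℤ) (hΔ : Δ.totalDegree ≤ D)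
    (hΛ : φ (spec q (lam n d)) ≠ 0) :
    φ (spec q (clearedEval n d D Δ)) =
      φ (spec q (lam n d)) ^ D *
        MvPolynomial.eval₂ (Int.castRingHom F)
          (fun b => φ (spec q (bivCoeff n d b)) / φ (spec q (lam n d))) Δ := by
  set Λ := φ (spec q (lam n d)) with hΛ_def
  set N : ℕ × ℕ → F := fun b => φ (spec q (bivCoeff n d b)) with hN_def
  have hcomp : ∀ b, Λ * (N b / Λ) = N b := fun b => mul_div_cancel₀ _ hΛ
  rw [← algebraMap_int_eq, ← MvPolynomial.aeval_def, clearedEval, map_sum, map_sum]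
  conv_rhs => rw [← sum_homogeneousComponent_of_le Δ hΔ, map_sum, Finset.mul_sum]
  refine Finset.sum_congr rfl fun k hk => ?_
  rw [Finset.mem_range] at hk
  rw [map_mul, map_mul, map_pow, map_pow, ringHom_aeval_int, ringHom_aeval_int]
  have hhom := aeval_smul_of_isHomogeneous (homogeneousComponent_isHomogeneous k Δ) Λ (fun b => N b / Λ)
  simp only [hcomp] at hhom
  change Λ ^ (D - k) * MvPolynomial.aeval N (homogeneousComponent k Δ) = _
  rw [show (fun i => N i) = N from rfl] at hhom
  rw [hhom, ← mul_assoc, ← pow_add, Nat.sub_add_cancel (by omega)]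

end KaltofenGeneric

end Literature.RingTheory.MvPolynomial

end
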